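import Literature.AnabelianGeometry.EtaleTheta.Thm56SubdagStatements
import Literature.AnabelianGeometry.EtaleTheta.FrobenioidThetaOfBiKummerData

/-!
# [EtTh] Thm. 5.6 proof, sub-node T56-L09b at the GENUINE §5 data: the part over `(l·Δ_Θ)_{B_N}` centralises `O^×(B_N)` (PDF p.103 = printed p.329)

Mochizuki, *The étale theta function …*, Publ. RIMS **45** (2009)
[cite: MochizukiEtTh2009, Thm 5.6 proof p.329 (PDF p.103)].  abc-iut cell, layer L2 — row «T56-L09b AT THE GENUINE DATA»
(abc-iut-L2-lead 02:50:51Z) of plan/L2/SUBDAG-EtTh-Thm56.md, seat abc-iut-w5-d020 (gen 2).  PROOF-ONLY (no definitions),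
over `Thm56SubdagStatements.lean` (`Thm56Sub.UnitsCentralUnderLDelta`, p417674) and abc-iut-L2-t4's W3-L2-01 constructor
`ThetaFrobenioid.ofBiKummerData` (FrobenioidThetaOfBiKummerData.lean p417743: the §5 data ASSEMBLED from the §3/§4
structures, `C :=` the setting's model tempered Frobenioid).

Printed step (p.329 l.19–21): «observing that the Kummer class of the "constant function" `u` does not affect the
restriction of the resulting Kummer classes to `(l·Δ_Θ)_{S₂}`, `(l·Δ_Θ)_{T₂}`» — i.e. (sub-DAG row T56-L09b) for `g` in the
part `P.pre` of `Aut_D(B_N^bs)` lying over `(l·Δ_Θ)_{B_N}`, the lift `s^⊓-gp_N(g) ∈ Aut_C(B_N)` commutes with the units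
`O^×(B_N)`.  What is DERIVED here, for the assembled data:
* MODEL LEMMA ([FrdI] Thm. 5.2 (ii), no binder): in the model Frobenioid, conjugating a unit `u ∈ O^×(Y)` by an
  automorphism `D` is the unit pull-back along `D⁻¹` (`ModelFrobenioid.conj_coe_units_eq_unitsPull`), so its
  rational-function component is `B(Base D⁻¹)(u_u)` (`ModelFrobenioid.unit_conj_units`); two units with the same
  component coincide (abc-iut-L2-t9's `unitsToRatFn_injective`, `Φ` integral);
* `unitsCentralUnderLDelta_ofBiKummerData`: `Thm56Sub.UnitsCentralUnderLDelta (ofBiKummerData …) P` from TWO NAMED inputs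
  the §5 interface does not expose — (hgeom) «the part of `Aut_D(B_N^bs)` over `(l·Δ_Θ)_{B_N}` is the image of the
  GEOMETRIC fundamental group `Δ^tp_X = Ker(Π^tp_X ↠ G_K)`» (§1 p.238 (PDF p.12): `l·Δ_Θ ⊆ Δ^tp_X` and
  `Ker(Π^tp_X ↠ (Π^tp_X)^Θ) ⊆ Δ^tp_X`; the `(l·Δ_Θ)_{(−)}`-subquotient structure is abc-iut-L2-t9's MERGE-PLAN row 2
  `autProj`, a free parameter `Q`/`P` of `ofBiKummerData`), and (hconst) «geometric automorphisms of `B_N^bs` fix the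
  divisor-free rational functions (the components of the units)» ([EtTh] Prop. 3.4 (ii) / Ex. 3.9: the units of the
  tempered Frobenioid are the constants `O^×_{K_{B_N}}`, on which `Δ^tp_X` acts trivially; GAP-LEDGER row G-w5d020-1 —
  abc-iut-L2-t3's `cnst` vocabulary is the eventual owner) — plus the section property of `s^trv_N = σ` ([FrdI] Prop. 5.6,
  t4's binder `hσ`).
With it, `Thm56Sub.CyclotomeCentralUnderLDelta` (P55-L02b) follows by `Thm56Sub.cyclotomeCentral_of_unitsCentral` (p417674).
HONEST FRAMING: kernel-checked implications between typed statements about the assembled §5 data; nothing of [EtTh] is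
asserted unconditionally; nothing asserts that such data exist for an actual curve; typed ≠ discharged; no side taken on
[IUTchIII] Cor. 3.12.
-/

noncomputable section

/-! ### The model Frobenioid: conjugating a unit by an automorphism is the unit pull-back along its inverse -/

namespace Literature.AlgebraicGeometry.Frobenioids

namespace ModelFrobenioid

open CategoryTheory Opposite

universe w v u

variable {D : Type u} [Category.{v} D] {Φ B : Dᵒᵖ ⥤ CommMonCat.{w}} {DivB : B ⟶ monoidGp Φ}

/-- **Conjugation of a unit is a unit pull-back**: for `D ∈ Aut_C(Y)` and `u ∈ O^×(Y)` in the model Frobenioid,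
`D · u · D⁻¹ = (D⁻¹)^*(u)` — from the intertwining square `φ^*(τ) ≫ φ = φ ≫ τ` of the LINEAR morphism `φ = D⁻¹`
(abc-iut-L2-t9's `comp_eq_unitsPull_comp`; [FrdI] Thm. 5.2 (ii)).  [cite: MochizukiFrdI2008, Thm. 5.2(ii) p.101] -/
theorem conj_coe_units_eq_unitsPull {Y : ModelFrobenioid Φ B DivB} (D' : Aut Y) (τ : units Y) :
    D' * (τ : Aut Y) * D'⁻¹ = ((unitsPull D'.inv τ : units Y) : Aut Y) := by
  have h := comp_eq_unitsPull_comp D'.inv (degFr_hom_eq_one D').2 τ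
  apply Aut.ext
  rw [Aut.Aut_mul_def, Aut.Aut_mul_def, Aut.Aut_inv_def, Iso.trans_hom, Iso.trans_hom, Iso.symm_hom]
  change D'.inv ≫ τ.1.hom ≫ D'.hom = (unitsPull D'.inv τ).1.hom
  rw [← Category.assoc, ← h, Category.assoc, D'.inv_hom_id, Category.comp_id]

/-- **The rational-function component of a conjugated unit**: `u_{D·u·D⁻¹} = B(Base D⁻¹)(u_u)` ([FrdI] Thm. 5.2 (ii):
`O^×(−) = Ker(B → Φ^gp)` transported along `Base`).  [cite: MochizukiFrdI2008, Thm. 5.2(ii) p.101] -/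
theorem unit_conj_units {Y : ModelFrobenioid Φ B DivB} (D' : Aut Y) (τ : units Y) :
    unit (D' * (τ : Aut Y) * D'⁻¹).hom = (B.map (baseMap D'.inv).op).hom (unit τ.1.hom) := by
  rw [conj_coe_units_eq_unitsPull]
  exact (unitsPull_hom_div_unit D'.inv τ).2

/-- **An automorphism whose base inverse fixes `u_u` commutes with the unit `u`** (for `Φ(Y^bs)` integral: a unit is
determined by its rational-function component, abc-iut-L2-t9's `unitsToRatFn_injective`).
[cite: MochizukiFrdI2008, Thm. 5.2(ii) p.101] -/
theorem mul_units_comm_of_unit_fixed {Y : ModelFrobenioid Φ B DivB} (hΦ : IsIntegral (Φ.obj (op Y.base)))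
    (D' : Aut Y) (τ : units Y) (hfix : (B.map (baseMap D'.inv).op).hom (unit τ.1.hom) = unit τ.1.hom) :
    D' * (τ : Aut Y) = (τ : Aut Y) * D' := by
  have hconj : D' * (τ : Aut Y) * D'⁻¹ = (τ : Aut Y) := by
    rw [conj_coe_units_eq_unitsPull]
    have heq : unitsPull D'.inv τ = τ := by
      apply unitsToRatFn_injective hΦ
      apply Units.ext
      rw [coe_unitsToRatFn, coe_unitsToRatFn, (unitsPull_hom_div_unit D'.inv τ).2, hfix]
    rw [heq]
  rw [← hconj, inv_mul_cancel_right, hconj]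

end ModelFrobenioid

end Literature.AlgebraicGeometry.Frobenioids

/-! ### T56-L09b for `ThetaFrobenioid.ofBiKummerData` -/

namespace Literature.AnabelianGeometry.EtaleTheta

open CategoryTheory Opposite Literature.AlgebraicGeometry.Frobenioids
open FrobenioidCyclotomicRigidity

namespace ThetaFrobenioid

universe u₀ v₀ u v w

variable {K : Type u₀} [Field K]
variable {X : SemiGraphs.TemperedArithmeticGroup.{u₀} K} {D₀ : Type u₀} [Category.{v₀} D₀]
  {V : FrdIMonoidStub.{w}} {T₀ : RealifiedDivisorMonoids (D₀ := D₀) V} {D : Type u} [Category.{v} D]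
  {VD : FrdICatStub.{u, v, w} D} {S : BiKummerSetting X T₀ D VD}
  {pullFrac : ∀ {A A' : S.C} (_ : A' ⟶ A), S.biratUnits A → S.biratUnits A'}
  {lv N : ℕ+} {T : ThetaEnvData.{max v w} N} {θ : S.biratUnits S.Aodot} {Bl : S.C}
  {Pl : S.FractionPair θ Bl} {Rl : S.NthRoot θ Pl lv pullFrac}
  (h : ModelFrobenioid.Hypotheses S.tf.divisorMonoid S.tf.ratFnFunctor)
  (toB : ∀ A : S.C, S.biratUnits A →* S.tf.biratUnitsModel A) (Q : FrobenioidTheta.ThetaSubquotientStub.{w} D)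
  (odd_l : Odd (lv : ℕ)) (R : S.NthRoot Rl.root Rl.pair N pullFrac) (ιX : T.PiX ≃ₜ* X.Pi)
  (hopen : IsOpen ((S.galoisSurj R.AN.base R.αData.isGalois).ker : Set X.Pi)) (σ : Aut R.AN.base →* Aut R.AN)
  (K' : Type w) [Field K'] (constEmb : K'ˣ →* S.tf.biratUnitsModel R.BN)
  (constEmb_injective : Function.Injective constEmb)
  (hdivc : ∀ g : Aut R.BN.base,
    ModelFrobenioid.div ((σ ((BiKummerSetting.NthRoot.baseIso S R).conjAut.symm g)).hom ≫ R.pair.num) =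
      ModelFrobenioid.div R.pair.num)
  (hdivp : ∀ y : T.PiYdd,
    ModelFrobenioid.div ((σ (S.galoisSurj R.AN.base R.αData.isGalois (ιX y.1))).hom ≫ R.pair.den) =
      ModelFrobenioid.div R.pair.den)

/-- **EtTh:Thm5.6(i)/T56-L09b at the assembled §5 data** (p.329 (PDF p.103) l.19–21: «the Kummer class of the "constant
function" `u` does not affect the restriction … to `(l·Δ_Θ)`»): `Thm56Sub.UnitsCentralUnderLDelta (ofBiKummerData …) P`
— every lift `s^⊓-gp_N(g)`, `g` over `(l·Δ_Θ)_{B_N}`, COMMUTES with `O^×(B_N)` — DERIVED from the model lemma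
`ModelFrobenioid.mul_units_comm_of_unit_fixed` and `(s^⊓-gp_N(g))^bs = g` (t4's `sgpCapSection_ofBiKummerData`, from the
section property `hσ` of `s^trv_N`, [FrdI] Prop. 5.6), MODULO the two named inputs: `hgeom` — the part `P.pre` over
`(l·Δ_Θ)_{B_N}` lies in the image `ρ(Δ^tp_X)` of the geometric fundamental group `Δ^tp_X = Ker(aug)` of the §2 data
(§1 p.238 (PDF p.12); MERGE-PLAN row 2) — and `hconst` — the rational-function components of the units of `B_N` are fixed by
`B(ρ δ)` for geometric `δ` ([EtTh] Prop. 3.4 (ii) / Ex. 3.9: units are constants; GAP-LEDGER G-w5d020-1).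
[cite: MochizukiEtTh2009, Thm 5.6 proof p.329 (PDF p.103); §1 p.238 (PDF p.12)] -/
theorem unitsCentralUnderLDelta_ofBiKummerData
    (hσ : ∀ g : Aut R.AN.base, ModelFrobenioid.baseMap (σ g).hom = g.hom)
    (P : ThetaSubquotientProj (ofBiKummerData h toB Q odd_l R ιX hopen σ K' constEmb constEmb_injective hdivc hdivp))
    (hgeom : P.pre R.BN.base ≤ T.aug.ker.map (rhoOfBiKummerData R ιX))
    (hconst : ∀ δ ∈ T.aug.ker, ∀ τ : ModelFrobenioid.units R.BN,
      (S.tf.ratFnFunctor.map (rhoOfBiKummerData R ιX δ).hom.op).hom (ModelFrobenioid.unit τ.1.hom) =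
        ModelFrobenioid.unit τ.1.hom) :
    Thm56Sub.UnitsCentralUnderLDelta
      (ofBiKummerData h toB Q odd_l R ιX hopen σ K' constEmb constEmb_injective hdivc hdivp) P := by
  intro g hg u hu
  -- `g = ρ(δ)` for a geometric `δ`
  obtain ⟨δ, hδ, rfl⟩ := hgeom hg
  -- the lift lies over `g`: `Base(s^⊓-gp_N(g)) = g`, hence `Base(s^⊓-gp_N(g)⁻¹) = g⁻¹ = ρ(δ⁻¹)`
  have hsec := sgpCapSection_ofBiKummerData h toB Q odd_l R ιX hopen σ K' constEmb constEmb_injective hdivc hdivp hσ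
    (rhoOfBiKummerData R ιX δ)
  have hinv : ModelFrobenioid.baseMap
      ((ofBiKummerData h toB Q odd_l R ιX hopen σ K' constEmb constEmb_injective hdivc hdivp).sgpCap
        (rhoOfBiKummerData R ιX δ)).inv = (rhoOfBiKummerData R ιX δ⁻¹).hom := by
    rw [map_inv]
    exact congrArg Iso.inv hsec
  -- the unit as a unit of the model Frobenioid
  have hu' : u ∈ ModelFrobenioid.units R.BN := hu
  have key := ModelFrobenioid.mul_units_comm_of_unit_fixed (S.isIntegral_of_hypotheses h (op R.BN.base))
    ((ofBiKummerData h toB Q odd_l R ιX hopen σ K' constEmb constEmb_injective hdivc hdivp).sgpCap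
      (rhoOfBiKummerData R ιX δ)) ⟨u, hu'⟩ (by
        rw [hinv]
        exact hconst δ⁻¹ (T.aug.ker.inv_mem hδ) ⟨u, hu'⟩)
  exact key

/-- **P55-L02b at the assembled data** falls out: the lifts over `(l·Δ_Θ)_{B_N}` commute with `μ_N(B_N) ⊆ O^×(B_N)`.
[cite: MochizukiEtTh2009, Prop 5.5 proof p.327 (PDF p.101)] -/
theorem cyclotomeCentralUnderLDelta_ofBiKummerData
    (hσ : ∀ g : Aut R.AN.base, ModelFrobenioid.baseMap (σ g).hom = g.hom)
    (P : ThetaSubquotientProj (ofBiKummerData h toB Q odd_l R ιX hopen σ K' constEmb constEmb_injective hdivc hdivp))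
    (hgeom : P.pre R.BN.base ≤ T.aug.ker.map (rhoOfBiKummerData R ιX))
    (hconst : ∀ δ ∈ T.aug.ker, ∀ τ : ModelFrobenioid.units R.BN,
      (S.tf.ratFnFunctor.map (rhoOfBiKummerData R ιX δ).hom.op).hom (ModelFrobenioid.unit τ.1.hom) =
        ModelFrobenioid.unit τ.1.hom) :
    Thm56Sub.CyclotomeCentralUnderLDelta
      (ofBiKummerData h toB Q odd_l R ιX hopen σ K' constEmb constEmb_injective hdivc hdivp) P :=
  Thm56Sub.cyclotomeCentral_of_unitsCentral _
    (unitsCentralUnderLDelta_ofBiKummerData h toB Q odd_l R ιX hopen σ K' constEmb constEmb_injective hdivc hdivp hσ P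
      hgeom hconst)

end ThetaFrobenioid

end Literature.AnabelianGeometry.EtaleTheta
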